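import Literature.NumberTheory.LFunctions.KMVHighDerivativeNonvanishing
import Mathlib.Analysis.SpecialFunctions.ImproperIntegrals
import Mathlib.MeasureTheory.Integral.ExpDecay
import HarnessLib

/-!
# Kowalski–Michel–VanderKam 2000, (21)–(22) at `k = 0`: the exact formula
# `Λ(f, ½)² = 2 q̂ Σ_{n₁,n₂ ≥ 1} λ_f(n₁) λ_f(n₂) (n₁n₂)^{−1/2} W(n₁n₂/q̂²)` and KMV's cut-off `W`

Source: E. Kowalski, P. Michel, J. VanderKam, *Non-vanishing of high derivatives of automorphic
`L`-functions at the center of the critical strip*, J. reine angew. Math. 526 (2000) 1–34 [held: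
paper:doi-10-1515-crll-2000-074], §5 p. 12: «The functional equation for `Λ(f, 1/2 + s)` has
always sign `+1` so manipulations similar as those performed in the previous section yield (…)»,
displays (21) (the weight `W(y) = (1/2πi) ∫_{(3)} Γ(1+t)² y^{−t} dt/t`) and (22) («decays faster
than any negative power of `y`»). At `k = 0` the printed display (p. 12, between (20) and (21))
reads, for `q` prime and `f ∈ S₂(q)^*`,

  `Λ(f, ½)² = 2 q̂ Σ_{n₁, n₂ ≥ 1} λ_f(n₁) λ_f(n₂) (n₁ n₂)^{−1/2} W(n₁ n₂ / q̂²)`,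

an EXACT identity (no root number: `ε_f² = 1`), with `Λ(f, s) = q̂^s Γ(s + ½) L(f, s)`,
`q̂ = √q / 2π` (the tree's `KMV2000.completedL`, `KMV2000.qhat`) and `λ_f(n) = a_f(n) n^{−1/2}`
(`GL2Family.heckeLambda`).

## What is here (statements-first; cell landau-siegel / ls-inputs, row H-AFE of INPUT LIST v1.3 §1H)

* `KMV2000.cutoffW` — KMV's cut-off `W` in CLOSED REAL FORM `W(y) = ∫_0^∞ e^{−u − y/u} du`
  (`= 2√y K₁(2√y)`). This is the inverse Mellin transform of `Γ(1+t)²/t = Γ(t)Γ(1+t)`, i.e. the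
  printed `(1/2πi) ∫_{(3)} Γ(1+t)² y^{−t} dt/t` (the Mellin pair is proved in the companion file
  `KMVCutoffWMellin`); the real form needs no Bessel function and no contour integral, and its
  basic properties (`W(0) = 1`, `0 ≤ W ≤ 1`, antitone, `W(y) ≤ 2 e^{−√y}`) are appended to this
  file as theorems (statements-first: this revision carries the three definitions only).
* `KMV2000.afeSqTerm q f (n₁, n₂)` — the summand `λ_f(n₁) λ_f(n₂) (n₁n₂)^{−1/2} W(n₁n₂/q̂²)`,
  indexed by `ℕ × ℕ` (it vanishes when `n₁ n₂ = 0`).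
* `KMV2000.completedL_half_sq_eq` — the NAMED STATEMENT (21)–(22) at `k = 0`, as printed
  (`q` prime, `f ∈ newforms0 q 2`): absolute convergence of the double series and the identity.
  It is PROVED in the companion file `KMVCentralValueSquaredAFEProofs`
  (`completedL_half_sq_eq_holds`), by a real-variable argument: Fricke symmetry of `f(iy)` on the
  imaginary axis splits `(∫_0^∞ f(iy) dy)²` in half along the hyperbola `y₁ y₂ = 1/q`.

## Relation to what the tree already types

`KMV2000.kmv2000_eq22` (`KMVHeckeRecursionExactAFE`) is the printed all-order fact (22) for
`Λ^{(k)}(f, ½)²`, `k ≥ 0`, with the Mellin–Barnes kernel `afeW q̂ i j n₁ n₂` (a line integral on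
`Re t = 3` of `k`-th derivatives of `q̂ᵗ Γ(1+t) n^{−t}`). The present statement is its `k = 0`
instance in closed form: `afeW q̂ 0 0 n₁ n₂ = W(n₁n₂/q̂²)` (proved in `KMVCutoffWMellin`), so
nothing is restated under a new meaning — `completedL_half_sq_eq` is the `k = 0` row of (22)
over the usable real-form weight that the consumers (the exact Petersson split of the mollified
second moment, route PrimeLevelFamEdge, crux `BeyondDiagonalBeatsQuarter`) manipulate.

## Not here

No moments, no mollifier, no Petersson formula; no claim about Landau–Siegel zeros.

## References

* [KowalskiMichelVanderKam2000] as above, §4 (13)–(15) p. 9, §5 (21)–(22) p. 12.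
-/

noncomputable section

open scoped MatrixGroups Real
open CongruenceSubgroup Complex Set MeasureTheory
open Literature.NumberTheory.EllipticCurves.ModularForms

namespace Literature.NumberTheory.LFunctions.KMV2000

/-! ### KMV's cut-off function `W` in real form -/

/-- **KMV's cut-off `W` (21), closed real form**: `W(y) := ∫_0^∞ e^{−u − y/u} du`
(`= 2√y K₁(2√y)`; for `y ≥ 0` the integrand is `≤ e^{−u}`, so the integral converges; for `y < 0`
the value is Mathlib's junk `0` of a non-integrable Bochner integral and is never used). It is the
inverse Mellin transform `(1/2πi) ∫_{(3)} Γ(1+t)² y^{−t} dt/t` printed in (21), since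
`∫_0^∞ W(y) y^{t−1} dy = Γ(t) Γ(1+t) = Γ(1+t)²/t` (`Re t > 0`).
[cite: KowalskiMichelVanderKam2000, (21) p. 12] -/
def cutoffW (y : ℝ) : ℝ :=
  ∫ u in Ioi (0 : ℝ), Real.exp (-u - y / u)

/-! ### The summand and the statement -/

variable (q : ℕ)

/-- The `(n₁, n₂)` summand of (21)–(22) at `k = 0`:
`λ_f(n₁) λ_f(n₂) (n₁ n₂)^{−1/2} W(n₁ n₂ / q̂²)`, indexed by `ℕ × ℕ`; it is `0` when `n₁ = 0` or
`n₂ = 0` (`λ_f(0) = 0`), so the series over `ℕ × ℕ` is the printed one over `n₁, n₂ ≥ 1`.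
[cite: KowalskiMichelVanderKam2000, (21) p. 12] -/
def afeSqTerm (f : CuspForm (Gamma0 q) 2) (n : ℕ × ℕ) : ℂ :=
  GL2Family.heckeLambda f n.1 * GL2Family.heckeLambda f n.2 *
    ((((n.1 : ℝ) * n.2) ^ (-(1 / 2 : ℝ)) : ℝ) : ℂ) * ((cutoffW ((n.1 : ℝ) * n.2 / qhat q ^ 2) : ℝ) : ℂ)

/-- **KMV 2000, (21)–(22) at `k = 0` (the exact «approximate functional equation» for
`Λ(f, ½)²`).** Printed (p. 12): «The functional equation for `Λ(f, 1/2 + s)` has always sign `+1`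
so manipulations similar as those performed in the previous section yield
`Λ^{(k)}(f,1/2)² = 2q̂ Σ_{n₁,n₂} λ_f(n₁)λ_f(n₂)(n₁n₂)^{−1/2} × (1/2πi)∫_{(3)} (…)^{(k)}(…)^{(k)} dt/t`»,
which at `k = 0` is `Λ(f, ½)² = 2 q̂ Σ_{n₁,n₂ ≥ 1} λ_f(n₁) λ_f(n₂) (n₁n₂)^{−1/2} W(n₁n₂/q̂²)` with
`W(y) = (1/2πi) ∫_{(3)} Γ(1+t)² y^{−t} dt/t` (21), «`W` decays faster than any negative power of
`y`» (22) — typed for `q` prime and `f ∈ S₂(q)^*` (`newforms0 q 2`) over `KMV2000.completedL`,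
`KMV2000.qhat`, `GL2Family.heckeLambda`, with `W = cutoffW` (real form) and the absolute
convergence of the double series as the `Summable` clause. The `k = 0` row of the tree's
all-order `kmv2000_eq22`. [cite: KowalskiMichelVanderKam2000, (21)–(22) p. 12] -/
def completedL_half_sq_eq : Prop :=
  ∀ (q : ℕ) [NeZero q], q.Prime → ∀ f ∈ newforms0 q 2,
    Summable (afeSqTerm q f) ∧
      completedL q f (1 / 2) ^ 2 = 2 * (qhat q : ℂ) * ∑' n : ℕ × ℕ, afeSqTerm q f n

end Literature.NumberTheory.LFunctions.KMV2000

end
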